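import Literature.Geometry.Riemannian.ParabolicNhdComparison
import Literature.Geometry.Riemannian.ParabolicBallCovering
import HarnessLib

/-!
# `P*`-parabolic neighbourhoods lie in conventional ones under a Ricci bound — the bootstrap step
# (Bamler 2020a, Cor. 9.6 (b); arXiv v1 Cor. 34 (b); auxiliary file)

R. Bamler, *Entropy and heat kernel bounds on a Ricci flow background*, arXiv:2008.07093 (2020a),
§9.1, Cor. 9.6 (b): `P*(x₀, t₀; A r, −T⁻ r², T⁺ r²) ⊂ P(x₀, t₀; A′ r, −T⁻ r², T⁺ r²)` if
`|Ric| ≤ K r⁻²` on the conventional neighbourhood `P(x₀, t₀; A′ r, …)`, `A′ ≥ A̲′(K, A, T^±)`. The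
printed proof (§9.2, (9.12)–(9.13)) reduces to `T⁻ = 0` and runs a bootstrap over a maximal time
`T*`, closed "by continuity". The tree proves the forward case (`T⁻ = 0`) by a DISCRETE bootstrap
along `H_m`-centres instead (`PParabolicNhdSubsetConventional.lean`); this file supplies its three
ingredients, for the metric flow `𝒳 = ricciFlowMetricFlow hh hR _ hflow` of a Ricci flow on a
closed manifold:

* `exists_wassersteinW1_condKernel_dirac_le_of_rough` — **rough ⇒ sharp localisation**
  (Prop. 9.5 / arXiv v1 Prop. 33 in `W₁`-form, `wassersteinW1_condKernel_dirac_le_of_ricci_bound`,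
  made applicable by the local distance distortion `ricci_bound_parabolic_of_ricci_bound_ball`):
  there is `C = C(m, K, T⁺)` such that if `|Ric| ≤ K r⁻²` on `B_{t₀}(x₀, A′ r) × [t₀, t₀ + T⁺ r²]`,
  `e^{K T⁺} √T⁺ < A′/2`, and `(z, s)`, `s ∈ [t₀, t₀ + T⁺ r²]`, has `d_{t₀}(x₀, z) < (A′/2) r`, then
  `d^{t₀}_{W₁}(ν_{z,s;t₀}, δ_z) ≤ C r`;
* `exists_edist_hCenter_le_of_global_ricci_bound` — **small-scale location of `H_m`-centres from
  a global (qualitative) Ricci bound** (Prop. 9.5 with `α = K = 1`): a universal `C₀ = C₀(m)` with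
  `d_{s′}(z, w) ≤ C₀ √(s − s′)` for every `H_m`-centre `(w, s′)` of `(z, s)` as soon as
  `|Ric| ≤ K_g` on `M × [a, T]` and `K_g (s − s′) ≤ 1`;
* `edist_lt_of_isHCenter_of_isHCenter` — **the bootstrap step**: for `(x, t)` of `P*`-level
  `d^{t₀}_{W₁}(δ_{x₀}, ν_{x,t;t₀}) < A r`, `H_m`-centres `z′` at `s′` and `z` at `s` of `(x, t)`,
  `t₀ ≤ s′ ≤ s ≤ t`, `s − s′ ≤ r²`, with `z′` sharply localised (`d_{W₁}(ν_{z′,s′;t₀}, δ_{z′}) ≤ c r`)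
  and the `H_m`-centres `w` of `(z, s)` at `s′` satisfying `d_{s′}(z, w) ≤ C₀ r`, one gets
  `d_{t₀}(x₀, z) < (A′/2) r` provided
  `A + √(H_m T⁺) + c + e^{K T⁺} (2√(H_m T⁺) + √H_m + C₀) ≤ A′/2`: the level of `z′` is at most
  `A r + √(H_m (t − s′))` (`IsHConcentrated.wassersteinW1_condKernel_le_of_isHCenter`), so
  `d_{t₀}(x₀, z′) < (A + √(H_m T⁺) + c) r`; `d_{s′}(z′, w) ≤ (2√(H_m T⁺) + √H_m) r`
  (`IsHCenter.edist_le_wassersteinW1_add` and the monotonicity of `d_{W₁}`, §2.4); and the local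
  backward distance distortion `edist_le_exp_mul_edist_of_ricci_bound_ball_rev` around `z′` turns
  `d_{s′}(z′, z) ≤ (2√(H_m T⁺) + √H_m + C₀) r` into `d_{t₀}(z′, z) ≤ e^{K T⁺} (…) r`.

Everything is proved; no definitions, no named facts.

## References

* R. H. Bamler, *Entropy and heat kernel bounds on a Ricci flow background*, arXiv:2008.07093
  (2020), §9.1, Prop. 9.5, Cor. 9.6 (b) (arXiv v1: Prop. 33, Cor. 34 (b)); §9.2, proofs,
  (9.12)–(9.13). [Bamler2020Entropy]
* R. H. Bamler, *Compactness theory of the space of super Ricci flows*, Invent. Math. 233 (2023),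
  §3.4 (`H`-centres). [Bamler2023]
-/

noncomputable section

open Set Filter Function MeasureTheory Measure
open scoped Manifold ContDiff Topology ENNReal NNReal

namespace Literature.Geometry.Riemannian

open Lorentzian Lorentzian.PseudoRiemannianMetric MetricFlow

universe u

/-! ### Rough ⇒ sharp localisation (Prop. 9.5 under the local curvature bound) -/

/-- **Rough localisation implies sharp localisation** (Bamler 2020a, §9.2, proof of Cor. 9.6 (b):
"by Proposition 9.5 … `d^{g_0}_{W₁}(δ_{x₀}, ν_{x,t;0}) + d^{g_0}_{W₁}(ν_{x,t;0}, δ_x) ≤ A + C(K, T)`",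
the second summand): for `m ≥ 3`, `K ≥ 0`, `T⁺ > 0` there is `C = C(m, K, T⁺) > 0` such that for
every Ricci flow on `[a, T]` of a smooth family of Riemannian metrics on a closed connected
`m`-manifold (metric flow `𝒳 = ricciFlowMetricFlow hh hR _ hflow`), `a < t₀`, `r > 0`,
`t₀ + T⁺ r² ≤ T`, `A′` with `e^{K T⁺} √T⁺ < A′/2`, a two-sided bound `|Ric_τ| ≤ (K/r²) g_τ` on
`B_{t₀}(x₀, A′ r) × [t₀, t₀ + T⁺ r²]`, and every `(z, s)`, `s ∈ [t₀, t₀ + T⁺ r²]`, with the ROUGH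
bound `d_{t₀}(x₀, z) < (A′/2) r`:

  `d^{t₀}_{W₁}(ν_{z,s;t₀}, δ_z) ≤ C r`

(`wassersteinW1_condKernel_dirac_le_of_ricci_bound`, i.e. Prop. 9.5 at `(z, s)` over `[t₀, s]`
with `α = 1`, whose curvature hypothesis on the balls `B_{t′}(z, √(s − t₀))` follows from the bound
on `B_{t₀}(z, (A′/2) r) ⊆ B_{t₀}(x₀, A′ r)` by `ricci_bound_parabolic_of_ricci_bound_ball`).
[cite: Bamler2020Entropy, §9.2, proof of Cor. 9.6 (b) (arXiv v1 Cor. 34 (b)); Prop. 9.5] -/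
theorem exists_wassersteinW1_condKernel_dirac_le_of_rough (m : ℕ) (hm : 3 ≤ m) {K Tp : ℝ}
    (hK : 0 ≤ K) (hTp : 0 < Tp) :
    ∃ C : ℝ, 0 < C ∧ ∀ {M : Type*} [TopologicalSpace M]
      [ChartedSpace (EuclideanSpace ℝ (Fin m)) M]
      [IsManifold 𝓘(ℝ, EuclideanSpace ℝ (Fin m)) ∞ M] [T2Space M] [CompactSpace M]
      [SecondCountableTopology M] [MeasurableSpace M] [BorelSpace M] [ConnectedSpace M]
      {h : ℝ → PseudoRiemannianMetric 𝓘(ℝ, EuclideanSpace ℝ (Fin m)) ∞ (EuclideanSpace ℝ (Fin m))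
        (TangentSpace 𝓘(ℝ, EuclideanSpace ℝ (Fin m)) : M → Type _)}
      {cov : ℝ → CovariantDerivative 𝓘(ℝ, EuclideanSpace ℝ (Fin m)) (EuclideanSpace ℝ (Fin m))
        (TangentSpace 𝓘(ℝ, EuclideanSpace ℝ (Fin m)) : M → Type _)}
      {a T : ℝ} (hflow : IsRicciFlow h cov (Icc a T)) (hh : IsContMDiffFamilyOn ∞ h univ)
      (hR : ∀ r, (h r).IsRiemannian),
      ∀ {A' t₀ r : ℝ} (ht₀ : t₀ ∈ Icc a T), a < t₀ → 0 < r → t₀ + Tp * r ^ 2 ≤ T →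
      Real.exp (K * Tp) * Real.sqrt Tp < A' / 2 → ∀ x₀ : M,
      (∀ τ ∈ Icc t₀ (t₀ + Tp * r ^ 2), ∀ y : M,
        (h t₀).edist (hR t₀) x₀ y < ENNReal.ofReal (A' * r) →
        ∀ v : TangentSpace 𝓘(ℝ, EuclideanSpace ℝ (Fin m)) y,
          |(cov τ).ricci y v v| ≤ K / r ^ 2 * (h τ).val y v v) →
      ∀ {s : ℝ} (hs : s ∈ Icc a T), t₀ ≤ s → s ≤ t₀ + Tp * r ^ 2 → ∀ z : M,
      (h t₀).edist (hR t₀) x₀ z < ENNReal.ofReal (A' / 2 * r) →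
      wassersteinW1 ((ricciFlowMetricFlow hh hR Set.ordConnected_Icc hflow).condKernel
          (t := ⟨s, hs⟩) z ⟨t₀, ht₀⟩)
        (Measure.dirac z : Measure ((ricciFlowMetricFlow hh hR Set.ordConnected_Icc hflow).Slice
          ⟨t₀, ht₀⟩)) ≤ ENNReal.ofReal (C * r) := by
  obtain ⟨C, hC, h95⟩ :=
    exists_edist_hCenter_le_of_ricci_bound m hm one_pos (K := K * (Tp + 1)) (by positivity)
  have hH0 : 0 ≤ MetricFlow.concentrationConst m := by
    have h3 : (3 : ℝ) ≤ m := by exact_mod_cast hm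
    have h1 : 0 ≤ ((m : ℝ) - 1) * Real.pi ^ 2 / 2 :=
      div_nonneg (mul_nonneg (by linarith only [h3]) (sq_nonneg _)) zero_le_two
    rw [MetricFlow.concentrationConst]
    linarith only [h1]
  refine ⟨(Real.sqrt (MetricFlow.concentrationConst m) + C) * Real.sqrt Tp, by positivity, ?_⟩
  intro M _ _ _ _ _ _ _ _ _ h cov a T hflow hh hR A' t₀ r ht₀ hat₀ hr hTT hA' x₀ hRic s hs h0s hsT
    z hrough
  have hr2 : 0 < r ^ 2 := pow_pos hr 2
  have hL0 : 0 ≤ Real.exp (K * Tp) * Real.sqrt Tp := by positivity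
  have hA'0 : 0 < A' := by linarith only [hA', hL0]
  have hA2 : 0 ≤ A' / 2 * r := by positivity
  -- the time interval `J = [t₀, t₀ + T⁺ r²]`
  have hJ : Icc t₀ (t₀ + Tp * r ^ 2) ⊆ Icc a T := Icc_subset_Icc ht₀.1 hTT
  have ht₀J : t₀ ∈ Icc t₀ (t₀ + Tp * r ^ 2) := ⟨le_rfl, by nlinarith only [hTp, hr2]⟩
  have hJΘ : t₀ + Tp * r ^ 2 - t₀ ≤ Tp * r ^ 2 := by linarith only
  have hkL : Real.exp (K / r ^ 2 * (t₀ + Tp * r ^ 2 - t₀)) ≤ Real.exp (K * Tp) := by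
    refine le_of_eq ?_
    congr 1
    field_simp; ring
  have hαL : Real.exp (K * Tp) * 1 * Real.sqrt Tp < A' / 2 := by rwa [mul_one]
  -- the curvature bound on `B_{t₀}(z, (A′/2) r) × J`
  have hRicz : ∀ τ ∈ Icc t₀ (t₀ + Tp * r ^ 2), ∀ y : M,
      (h t₀).edist (hR t₀) z y < ENNReal.ofReal (A' / 2 * r) →
      ∀ X : TangentSpace 𝓘(ℝ, EuclideanSpace ℝ (Fin m)) y,
        |(cov τ).ricci y X X| ≤ K / r ^ 2 * (h τ).val y X X := by
    intro τ hτ y hy X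
    refine hRic τ hτ y ?_ X
    calc (h t₀).edist (hR t₀) x₀ y ≤ (h t₀).edist (hR t₀) x₀ z + (h t₀).edist (hR t₀) z y :=
          (h t₀).edist_triangle (hR t₀) x₀ z y
      _ < ENNReal.ofReal (A' / 2 * r) + ENNReal.ofReal (A' / 2 * r) := ENNReal.add_lt_add hrough hy
      _ = ENNReal.ofReal (A' * r) := by rw [← ENNReal.ofReal_add hA2 hA2]; ring_nf
  exact wassersteinW1_condKernel_dirac_le_of_ricci_bound hm hflow hh hR hC.le ht₀ hs h0s hTp.le hr.le
    (by linarith only [hsT]) z fun hlt w hw ↦ h95 hflow hh hR hat₀ hlt hs.2 z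
      (ricci_bound_parabolic_of_ricci_bound_ball hflow hR hJ ht₀J hK hr hTp.le hJΘ hkL one_pos hαL z
        hRicz ⟨h0s, hsT⟩ hlt) w hw

/-! ### Small-scale location of `H_m`-centres from a global Ricci bound -/

/-- **`H_m`-centres over short times stay close, uniformly** (Bamler 2020a, Prop. 9.5 / arXiv v1
Prop. 33 with `α = K = 1`, at a scale below the global curvature scale): there is a universal
`C₀ = C₀(m) > 0` such that for every Ricci flow on `[a, T]` of a smooth family of Riemannian metrics
on a closed connected `m`-manifold with a (qualitative) global bound `|Ric_τ| ≤ K_g g_τ` on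
`M × [a, T]`, all `a < s′ < s ≤ T` with `K_g (s − s′) ≤ 1`, every `z` and every `H_m`-centre
`(w, s′)` of `(z, s)` (`∫ d_{s′}(w, ·)² dν_{z,s;s′} ≤ H_m (s − s′)`):

  `d_{s′}(z, w) ≤ C₀ √(s − s′)`

(`exists_edist_hCenter_le_of_ricci_bound`: its curvature hypothesis `|Ric| ≤ (s − s′)⁻¹` on the
balls `B_{t′}(z, √(s − s′))` holds everywhere since `K_g ≤ (s − s′)⁻¹`).
[cite: Bamler2020Entropy, §9.1, Prop. 9.5 (arXiv v1 Prop. 33)] -/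
theorem exists_edist_hCenter_le_of_global_ricci_bound (m : ℕ) (hm : 3 ≤ m) :
    ∃ C₀ : ℝ, 0 < C₀ ∧ ∀ {M : Type*} [TopologicalSpace M]
      [ChartedSpace (EuclideanSpace ℝ (Fin m)) M]
      [IsManifold 𝓘(ℝ, EuclideanSpace ℝ (Fin m)) ∞ M] [T2Space M] [CompactSpace M]
      [SecondCountableTopology M] [MeasurableSpace M] [BorelSpace M] [ConnectedSpace M]
      {h : ℝ → PseudoRiemannianMetric 𝓘(ℝ, EuclideanSpace ℝ (Fin m)) ∞ (EuclideanSpace ℝ (Fin m))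
        (TangentSpace 𝓘(ℝ, EuclideanSpace ℝ (Fin m)) : M → Type _)}
      {cov : ℝ → CovariantDerivative 𝓘(ℝ, EuclideanSpace ℝ (Fin m)) (EuclideanSpace ℝ (Fin m))
        (TangentSpace 𝓘(ℝ, EuclideanSpace ℝ (Fin m)) : M → Type _)}
      {a T : ℝ} (hflow : IsRicciFlow h cov (Icc a T)) (hh : IsContMDiffFamilyOn ∞ h univ)
      (hR : ∀ r, (h r).IsRiemannian),
      ∀ {Kg : ℝ}, (∀ τ ∈ Icc a T, ∀ (y : M) (v : TangentSpace 𝓘(ℝ, EuclideanSpace ℝ (Fin m)) y),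
        |(cov τ).ricci y v v| ≤ Kg * (h τ).val y v v) →
      ∀ {s' s : ℝ}, a < s' → s' < s → s ≤ T → Kg * (s - s') ≤ 1 → ∀ z w : M,
      ∫⁻ y, (h s').edist (hR s') w y ^ 2 ∂(heatKernelMeasure hh hR s z s') ≤
        ENNReal.ofReal ((((m : ℝ) - 1) * Real.pi ^ 2 / 2 + 4) * (s - s')) →
      ((h s').edist (hR s') z w).toReal ≤ C₀ * Real.sqrt (s - s') := by
  obtain ⟨C₀, hC₀, h95⟩ := exists_edist_hCenter_le_of_ricci_bound m hm one_pos (K := 1) zero_le_one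
  refine ⟨C₀, hC₀, ?_⟩
  intro M _ _ _ _ _ _ _ _ _ h cov a T hflow hh hR Kg hKg s' s has' hs's hsT hKδ z w hw
  have hτ : 0 < s - s' := sub_pos.2 hs's
  have hKg1 : Kg ≤ 1 / (s - s') := by rw [le_div_iff₀ hτ]; exact hKδ
  refine h95 hflow hh hR has' hs's hsT z (fun τ hτ y _ v ↦ ?_) w hw
  have hτT : τ ∈ Icc a T := ⟨has'.le.trans hτ.1, hτ.2.trans hsT⟩
  have hval : 0 ≤ (h τ).val y v v := by
    by_cases hv : v = 0
    · subst hv; simp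
    · exact (hR τ y v hv).le
  exact (hKg τ hτT y v).trans (mul_le_mul_of_nonneg_right hKg1 hval)

/-! ### The bootstrap step -/

section Step

variable {m : ℕ} {M : Type u} [TopologicalSpace M] [ChartedSpace (EuclideanSpace ℝ (Fin m)) M]
  [IsManifold 𝓘(ℝ, EuclideanSpace ℝ (Fin m)) ∞ M] [T2Space M] [CompactSpace M]
  [SecondCountableTopology M] [MeasurableSpace M] [BorelSpace M] [ConnectedSpace M]
  {h : ℝ → PseudoRiemannianMetric 𝓘(ℝ, EuclideanSpace ℝ (Fin m)) ∞ (EuclideanSpace ℝ (Fin m))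
    (TangentSpace 𝓘(ℝ, EuclideanSpace ℝ (Fin m)) : M → Type _)}
  {cov : ℝ → CovariantDerivative 𝓘(ℝ, EuclideanSpace ℝ (Fin m)) (EuclideanSpace ℝ (Fin m))
    (TangentSpace 𝓘(ℝ, EuclideanSpace ℝ (Fin m)) : M → Type _)}
  {a T : ℝ} (hflow : IsRicciFlow h cov (Icc a T)) (hh : IsContMDiffFamilyOn ∞ h univ)
  (hR : ∀ r, (h r).IsRiemannian)

local notation "𝒳" => ricciFlowMetricFlow hh hR Set.ordConnected_Icc hflow

/-- **The bootstrap step along `H_m`-centres** (replacing the "by continuity" step of Bamler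
2020a, §9.2, proof of Cor. 9.6 (b), (9.12)–(9.13)). Data: a Ricci flow on `[a, T]` of a smooth
family of Riemannian metrics on a closed connected `m`-manifold (`m ≥ 3`), `r > 0`, times
`t₀ ≤ s′ ≤ s ≤ t ≤ t₀ + T⁺ r² ≤ T` with `s − s′ ≤ r²`, `|Ric_τ| ≤ (K/r²) g_τ` on
`B_{t₀}(x₀, A′ r) × [t₀, t₀ + T⁺ r²]`, a point `x` of `P*`-level
`d^{t₀}_{W₁}(ν_{x₀,t₀;t₀}, ν_{x,t;t₀}) < A r`, `H_m`-centres `z′` at `s′` and `z` at `s` of `(x, t)`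
such that `z′` is sharply localised, `d^{t₀}_{W₁}(ν_{z′,s′;t₀}, δ_{z′}) ≤ c r`, and every `H_m`-centre
`w` of `(z, s)` at `s′` has `d_{s′}(z, w) ≤ C₀ r`. If
`A + √(H_m T⁺) + c + e^{K T⁺} (2√(H_m T⁺) + √H_m + C₀) ≤ A′/2`, then `d_{t₀}(x₀, z) < (A′/2) r`.
Proof: the level of `z′` is `≤ A r + √(H_m (t − s′))` (`wassersteinW1_condKernel_le_of_isHCenter`),
so `d_{t₀}(x₀, z′) = d_{W₁}(δ_{x₀}, δ_{z′}) < (A + √(H_m T⁺) + c) r`; for an `H_m`-centre `w` of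
`(z, s)` at `s′`, `d_{s′}(z′, w) ≤ √(H_m(t − s′)) + d^{s′}_{W₁}(ν_{x,t;s′}, ν_{z,s;s′}) + √(H_m(s − s′))`
(`IsHCenter.edist_le_wassersteinW1_add`) with the middle term `≤ d^{s}_{W₁}(ν_{x,t;s}, δ_z) ≤
√(H_m (t − s))` (monotonicity of `d_{W₁}`), whence `d_{s′}(z′, z) ≤ (2√(H_m T⁺) + √H_m + C₀) r`, and
the backward distance distortion around the localised point `z′`
(`edist_le_exp_mul_edist_of_ricci_bound_ball_rev`) gives `d_{t₀}(z′, z) ≤ e^{K T⁺} (…) r`.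
[cite: Bamler2020Entropy, §9.2, proof of Cor. 9.6 (b) (arXiv v1 Cor. 34 (b)), (9.12)–(9.13)] -/
theorem edist_lt_of_isHCenter_of_isHCenter (hm : 3 ≤ m) {K Tp A A' c C₀ r t₀ t s' s : ℝ}
    (hK : 0 ≤ K) (hTp : 0 ≤ Tp) (hc : 0 ≤ c) (hC₀ : 0 ≤ C₀) (hr : 0 < r)
    (hA' : A + Real.sqrt (MetricFlow.concentrationConst m * Tp) + c +
      Real.exp (K * Tp) * (2 * Real.sqrt (MetricFlow.concentrationConst m * Tp) +
        Real.sqrt (MetricFlow.concentrationConst m) + C₀) ≤ A' / 2)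
    (ht₀ : t₀ ∈ Icc a T) (ht : t ∈ Icc a T) (hs' : s' ∈ Icc a T) (hs : s ∈ Icc a T)
    (h0s' : t₀ ≤ s') (hs's : s' ≤ s) (hst : s ≤ t) (htT : t ≤ t₀ + Tp * r ^ 2)
    (hTT : t₀ + Tp * r ^ 2 ≤ T) (hδ : s - s' ≤ r ^ 2) (x₀ : M)
    (hRic : ∀ τ ∈ Icc t₀ (t₀ + Tp * r ^ 2), ∀ y : M,
      (h t₀).edist (hR t₀) x₀ y < ENNReal.ofReal (A' * r) →
      ∀ v : TangentSpace 𝓘(ℝ, EuclideanSpace ℝ (Fin m)) y,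
        |(cov τ).ricci y v v| ≤ K / r ^ 2 * (h τ).val y v v)
    (x : M) (hℓ : wassersteinW1 ((𝒳).condKernel (t := ⟨t₀, ht₀⟩) x₀ ⟨t₀, ht₀⟩)
      ((𝒳).condKernel (t := ⟨t, ht⟩) x ⟨t₀, ht₀⟩) < ENNReal.ofReal (A * r))
    {z' z : M}
    (hz' : (𝒳).IsHCenter (MetricFlow.concentrationConst m) (s := ⟨s', hs'⟩) (t := ⟨t, ht⟩) z' x)
    (hz : (𝒳).IsHCenter (MetricFlow.concentrationConst m) (s := ⟨s, hs⟩) (t := ⟨t, ht⟩) z x)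
    (hsharp : wassersteinW1 ((𝒳).condKernel (t := ⟨s', hs'⟩) z' ⟨t₀, ht₀⟩)
      (Measure.dirac z' : Measure ((𝒳).Slice ⟨t₀, ht₀⟩)) ≤ ENNReal.ofReal (c * r))
    (hsmall : ∀ w : M, (𝒳).IsHCenter (MetricFlow.concentrationConst m) (s := ⟨s', hs'⟩)
      (t := ⟨s, hs⟩) w z → (h s').edist (hR s') z w ≤ ENNReal.ofReal (C₀ * r)) :
    (h t₀).edist (hR t₀) x₀ z < ENNReal.ofReal (A' / 2 * r) := by
  -- constants
  set H : ℝ := MetricFlow.concentrationConst m with hHdef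
  have hH0 : 0 ≤ H := by
    have h3 : (3 : ℝ) ≤ m := by exact_mod_cast hm
    have h1 : 0 ≤ ((m : ℝ) - 1) * Real.pi ^ 2 / 2 :=
      div_nonneg (mul_nonneg (by linarith only [h3]) (sq_nonneg _)) zero_le_two
    rw [hHdef, MetricFlow.concentrationConst]
    linarith only [h1]
  set P : ℝ := Real.sqrt (H * Tp) with hP
  set L : ℝ := Real.exp (K * Tp) with hL
  set D₁ : ℝ := A + P + c with hD₁
  set C₂ : ℝ := 2 * P + Real.sqrt H + C₀ with hC₂
  have hP0 : 0 ≤ P := Real.sqrt_nonneg _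
  have hL0 : 0 < L := Real.exp_pos _
  have hC₂0 : 0 ≤ C₂ := by positivity
  have hA0 : 0 < A := by
    by_contra hA0
    have : ENNReal.ofReal (A * r) = 0 := ENNReal.ofReal_eq_zero.2 (by nlinarith only [not_lt.1 hA0, hr])
    rw [this] at hℓ
    exact ENNReal.not_lt_zero hℓ
  have hD₁0 : 0 ≤ D₁ := by positivity
  have hAD : D₁ + L * C₂ ≤ A' / 2 := hA'
  have hr2 : 0 < r ^ 2 := pow_pos hr 2
  have h0t : t₀ ≤ t := h0s'.trans (hs's.trans hst)
  have hts' : t - s' ≤ Tp * r ^ 2 := by linarith only [htT, h0s']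
  have hts : t - s ≤ Tp * r ^ 2 := by linarith only [htT, h0s', hs's]
  let X : MetricFlow (Icc a T) := 𝒳
  have hm0 : 0 < m := by omega
  have hHc : X.IsHConcentrated H := ricciFlowMetricFlow_isHConcentrated hm0 hh hR _ hflow
  -- the three radii `√(H_m τ) ≤ √(H_m T⁺) r`, `√(H_m (s − s′)) ≤ √H_m r`
  have hsq1 : (ENNReal.ofReal (H * (t - s'))) ^ (1 / 2 : ℝ) ≤ ENNReal.ofReal (P * r) :=
    ofReal_mul_rpow_half_le_ofReal_sqrt_mul hH0 (by linarith only [hs's, hst]) hr.le hts'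
  have hsq2 : (ENNReal.ofReal (H * (t - s))) ^ (1 / 2 : ℝ) ≤ ENNReal.ofReal (P * r) :=
    ofReal_mul_rpow_half_le_ofReal_sqrt_mul hH0 (sub_nonneg.2 hst) hr.le hts
  have hsq3 : (ENNReal.ofReal (H * (s - s'))) ^ (1 / 2 : ℝ) ≤ ENNReal.ofReal (Real.sqrt H * r) := by
    have := ofReal_mul_rpow_half_le_ofReal_sqrt_mul (Θ := 1) hH0 (sub_nonneg.2 hs's) hr.le
      (by rw [one_mul]; exact hδ)
    rwa [mul_one] at this
  /- (i) the level of `z′` and its sharp localisation: `d_{t₀}(x₀, z′) < D₁ r` -/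
  have hlev : wassersteinW1 (X.condKernel (t := ⟨t₀, ht₀⟩) x₀ ⟨t₀, ht₀⟩)
      (X.condKernel (t := ⟨s', hs'⟩) z' ⟨t₀, ht₀⟩) ≤
        wassersteinW1 (X.condKernel (t := ⟨t₀, ht₀⟩) x₀ ⟨t₀, ht₀⟩)
          (X.condKernel (t := ⟨t, ht⟩) x ⟨t₀, ht₀⟩) +
          (ENNReal.ofReal (H * (t - s'))) ^ (1 / 2 : ℝ) := by
    have h1 := hHc.wassersteinW1_condKernel_le_of_isHCenter (sm := ⟨t₀, ht₀⟩) (s₀ := ⟨t₀, ht₀⟩)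
      (t₀ := ⟨t₀, ht₀⟩) (x₀ := x₀) hz' z' le_rfl le_rfl h0t h0s'
    rwa [PseudoEMetricSpace.edist_self, add_zero] at h1
  have hself : X.condKernel (t := ⟨t₀, ht₀⟩) x₀ ⟨t₀, ht₀⟩ =
      (Measure.dirac x₀ : Measure (X.Slice ⟨t₀, ht₀⟩)) := X.condKernel_self x₀
  haveI := X.isProbabilityMeasure_condKernel (s := ⟨t₀, ht₀⟩) (t := ⟨s', hs'⟩) z' h0s'
  have hD₁lt : (h t₀).edist (hR t₀) x₀ z' < ENNReal.ofReal (D₁ * r) := by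
    show edist (show X.Slice ⟨t₀, ht₀⟩ from x₀) (show X.Slice ⟨t₀, ht₀⟩ from z') < _
    rw [← wassersteinW1_dirac_dirac]
    calc wassersteinW1 (Measure.dirac (show X.Slice ⟨t₀, ht₀⟩ from x₀))
          (Measure.dirac (show X.Slice ⟨t₀, ht₀⟩ from z'))
        ≤ wassersteinW1 (Measure.dirac (show X.Slice ⟨t₀, ht₀⟩ from x₀))
              (X.condKernel (t := ⟨s', hs'⟩) z' ⟨t₀, ht₀⟩) +
            wassersteinW1 (X.condKernel (t := ⟨s', hs'⟩) z' ⟨t₀, ht₀⟩)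
              (Measure.dirac (show X.Slice ⟨t₀, ht₀⟩ from z')) := wassersteinW1_triangle _ _ _
      _ ≤ (wassersteinW1 (X.condKernel (t := ⟨t₀, ht₀⟩) x₀ ⟨t₀, ht₀⟩)
              (X.condKernel (t := ⟨t, ht⟩) x ⟨t₀, ht₀⟩) +
            (ENNReal.ofReal (H * (t - s'))) ^ (1 / 2 : ℝ)) + ENNReal.ofReal (c * r) := by
          rw [← hself]
          exact add_le_add hlev hsharp
      _ < ENNReal.ofReal (A * r) + ENNReal.ofReal (P * r) + ENNReal.ofReal (c * r) :=
          ENNReal.add_lt_add_of_lt_of_le ENNReal.ofReal_ne_top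
            (ENNReal.add_lt_add_of_lt_of_le (ne_top_of_le_ne_top ENNReal.ofReal_ne_top hsq1)
              hℓ hsq1) le_rfl
      _ = ENNReal.ofReal (D₁ * r) := by
          rw [← ENNReal.ofReal_add (by positivity) (by positivity),
            ← ENNReal.ofReal_add (by positivity) (by positivity), hD₁]
          ring_nf
  /- (ii) an `H_m`-centre `w` of `(z, s)` at `s′`; `d_{s′}(z′, z) ≤ C₂ r` -/
  obtain ⟨w, hw⟩ := hHc.exists_isHCenter (s := ⟨s', hs'⟩) (t := ⟨s, hs⟩) hs's z
  have hzw : (h s').edist (hR s') z w ≤ ENNReal.ofReal (C₀ * r) := hsmall w hw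
  have hmid : wassersteinW1 (X.condKernel (t := ⟨t, ht⟩) x ⟨s', hs'⟩)
      (X.condKernel (t := ⟨s, hs⟩) z ⟨s', hs'⟩) ≤ (ENNReal.ofReal (H * (t - s))) ^ (1 / 2 : ℝ) := by
    refine (hHc.wassersteinW1_condKernel_mono' (s := ⟨s', hs'⟩) (s' := ⟨s, hs⟩) hs's hst le_rfl
      x z).trans ?_
    rw [X.condKernel_self, wassersteinW1_comm]
    exact hz.wassersteinW1_dirac_le
  have hz'w : (h s').edist (hR s') z' w ≤ ENNReal.ofReal ((2 * P + Real.sqrt H) * r) := by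
    have hG := hz'.edist_le_wassersteinW1_add hw
    refine hG.trans ?_
    calc (ENNReal.ofReal (H * (t - s'))) ^ (1 / 2 : ℝ) +
          wassersteinW1 (X.condKernel (t := ⟨t, ht⟩) x ⟨s', hs'⟩)
            (X.condKernel (t := ⟨s, hs⟩) z ⟨s', hs'⟩) +
          (ENNReal.ofReal (H * (s - s'))) ^ (1 / 2 : ℝ)
        ≤ ENNReal.ofReal (P * r) + ENNReal.ofReal (P * r) + ENNReal.ofReal (Real.sqrt H * r) :=
          add_le_add (add_le_add hsq1 (hmid.trans hsq2)) hsq3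
      _ = ENNReal.ofReal ((2 * P + Real.sqrt H) * r) := by
          rw [← ENNReal.ofReal_add (by positivity) (by positivity),
            ← ENNReal.ofReal_add (by positivity) (by positivity)]
          ring_nf
  have hz'z : (h s').edist (hR s') z' z ≤ ENNReal.ofReal (C₂ * r) :=
    calc (h s').edist (hR s') z' z ≤ (h s').edist (hR s') z' w + (h s').edist (hR s') w z :=
          (h s').edist_triangle (hR s') z' w z
      _ ≤ ENNReal.ofReal ((2 * P + Real.sqrt H) * r) + ENNReal.ofReal (C₀ * r) := by
          rw [(h s').edist_comm (hR s') w z]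
          exact add_le_add hz'w hzw
      _ = ENNReal.ofReal (C₂ * r) := by
          rw [← ENNReal.ofReal_add (by positivity) (by positivity), hC₂]
          ring_nf
  /- (iii) backward distance distortion around `z′`: `d_{t₀}(z′, z) ≤ L C₂ r` -/
  have hJ : Icc t₀ (t₀ + Tp * r ^ 2) ⊆ Icc a T := Icc_subset_Icc ht₀.1 hTT
  have ht₀J : t₀ ∈ Icc t₀ (t₀ + Tp * r ^ 2) := ⟨le_rfl, by nlinarith only [hTp, hr2]⟩
  have hs'J : s' ∈ Icc t₀ (t₀ + Tp * r ^ 2) := ⟨h0s', hs's.trans (hst.trans htT)⟩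
  have hK₁ : 0 ≤ K / r ^ 2 := div_nonneg hK hr2.le
  have hexp : Real.exp (K / r ^ 2 * (t₀ + Tp * r ^ 2 - t₀)) = L := by
    rw [hL]
    congr 1
    field_simp; ring
  have hAD₁ : 0 ≤ A' - D₁ := by nlinarith only [hAD, hD₁0, hL0, hC₂0]
  have hRic' : ∀ τ ∈ Icc t₀ (t₀ + Tp * r ^ 2), ∀ y : M,
      (h t₀).edist (hR t₀) z' y < ENNReal.ofReal ((A' - D₁) * r) →
      ∀ v : TangentSpace 𝓘(ℝ, EuclideanSpace ℝ (Fin m)) y,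
        |(cov τ).ricci y v v| ≤ K / r ^ 2 * (h τ).val y v v := fun τ hτ y hy v ↦ by
    refine hRic τ hτ y ?_ v
    calc (h t₀).edist (hR t₀) x₀ y ≤ (h t₀).edist (hR t₀) x₀ z' + (h t₀).edist (hR t₀) z' y :=
          (h t₀).edist_triangle (hR t₀) x₀ z' y
      _ < ENNReal.ofReal (D₁ * r) + ENNReal.ofReal ((A' - D₁) * r) := ENNReal.add_lt_add hD₁lt hy
      _ = ENNReal.ofReal (A' * r) := by
          rw [← ENNReal.ofReal_add (by positivity) (by positivity)]
          ring_nf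
  have hy : ENNReal.ofReal (Real.exp (K / r ^ 2 * (t₀ + Tp * r ^ 2 - t₀))) *
      (h s').edist (hR s') z' z < ENNReal.ofReal ((A' - D₁) * r) := by
    rw [hexp]
    calc ENNReal.ofReal L * (h s').edist (hR s') z' z
        ≤ ENNReal.ofReal L * ENNReal.ofReal (C₂ * r) := mul_le_mul' le_rfl hz'z
      _ = ENNReal.ofReal (L * C₂ * r) := by rw [← ENNReal.ofReal_mul hL0.le, mul_assoc]
      _ < ENNReal.ofReal ((A' - D₁) * r) := by
          refine (ENNReal.ofReal_lt_ofReal_iff (mul_pos ?_ hr)).2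
            (mul_lt_mul_of_pos_right ?_ hr)
          · nlinarith only [hAD, hD₁0, hL0, hC₂0, hA0, hP0, hc]
          · nlinarith only [hAD, hD₁0, hL0, hC₂0, hA0, hP0, hc]
  have hdist : (h t₀).edist (hR t₀) z' z ≤ ENNReal.ofReal (L * C₂ * r) := by
    refine (edist_le_exp_mul_edist_of_ricci_bound_ball_rev hflow hR hJ hK₁ ht₀J z' hRic' hs'J
      hy).trans ?_
    rw [hexp]
    calc ENNReal.ofReal L * (h s').edist (hR s') z' z
        ≤ ENNReal.ofReal L * ENNReal.ofReal (C₂ * r) := mul_le_mul' le_rfl hz'z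
      _ = ENNReal.ofReal (L * C₂ * r) := by rw [← ENNReal.ofReal_mul hL0.le, mul_assoc]
  /- (iv) conclusion -/
  calc (h t₀).edist (hR t₀) x₀ z ≤ (h t₀).edist (hR t₀) x₀ z' + (h t₀).edist (hR t₀) z' z :=
        (h t₀).edist_triangle (hR t₀) x₀ z' z
    _ < ENNReal.ofReal (D₁ * r) + ENNReal.ofReal (L * C₂ * r) :=
        ENNReal.add_lt_add_of_lt_of_le (PseudoRiemannianMetric.edist_ne_top (hR t₀) z' z) hD₁lt
          hdist
    _ = ENNReal.ofReal ((D₁ + L * C₂) * r) := by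
        rw [← ENNReal.ofReal_add (by positivity) (by positivity)]
        ring_nf
    _ ≤ ENNReal.ofReal (A' / 2 * r) :=
        ENNReal.ofReal_le_ofReal (mul_le_mul_of_nonneg_right hAD hr.le)

end Step

end Literature.Geometry.Riemannian

end
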